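import Summits.AtomisticToContinuum.Crystallization.Theses.PalmUnimodularRigidity
import Literature.Probability.Process.PointStationaryLaw
import Literature.MathematicalPhysics.StatisticalMechanics.RootEnergy

/-!
# Negative knowledge for crux `MinimiserShells` (stmt-AtomisticToContinuum-9225) — LOAD-BEARING
# hypotheses and the false POINTWISE version (standing disprover, gen 1)

`PalmUnimodularRigidity.MinimiserShells` says: every minimising (`E_P[h] ≤ e*`) point-stationary
`δ`-hard-core probability law on rooted configurations of `ℝ³` has a `(a/100)`-close-packed root
shell almost surely (`minimiserShells_iff`, `Iff.rfl` against `IsRootedHardCore` /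
`IsPointStationaryLaw`).  Certified here:

* `minimiserShells_false_without_energy` — with the minimising hypothesis dropped the statement is
  FALSE: the lone root `δ_{δ_0}` is a point-stationary hard-core probability law with an empty shell.
* `minimiserShells_false_without_stationarity` — with the Mecke identity dropped it is FALSE: the
  deterministic COLLINEAR COMB (root plus `m = ⌈−2000 e*⌉₊` points on the segment `[3/2, 2)·e₀`,
  spacing `1/(2m+2)`) has ROOT energy `≤ −m/2000 ≤ e*` and an empty root shell.  The minimising
  hypothesis localises nothing by itself; shell structure can only come from re-rooting.
* `not_pointwiseMinimiserShells` — the natural pointwise strengthening ("a rooted hard-core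
  configuration whose root energy is `≤ e*` has a good root shell") is FALSE (same comb): a
  transfer-free pointwise certificate `h ≥ e* + c·1[bad shell]` cannot exist.

Helpers of independent use: `not_goodShell_of_far` (an empty `5/4`-ball is never a good shell),
`measurableSet_setOf_eq_count_restrict` (the Giry σ-algebra separates `count|F`, `F` finite),
`meanRootEnergy_dirac_count_restrict`, `lennardJones_le_on_comb_annulus` (`V_LJ ≤ −1/1000` on
`[3/2, 2]`).  Supports item stmt-AtomisticToContinuum-9225; workfile
`Cruxes/MinimiserShells/Disproof.lean`.
-/

noncomputable section

open MeasureTheory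
open scoped ENNReal BigOperators

namespace Summit.AtomisticToContinuum.Crystallization.Theorems.MinimiserShells.Negative.LoadBearing

open Literature.Probability.Process
open Literature.MathematicalPhysics.StatisticalMechanics
open Literature.Geometry.DiscreteGeometry
open Summit.AtomisticToContinuum.Crystallization.Theses.PalmUnimodularRigidity (MinimiserShells)

/-! ## Read-back -/

/-- `e* = ⨅_Q e_LJ(Q)` over periodic configurations (the route's inlined infimum). -/
def eStar : ℝ := ⨅ Q : PeriodicConfiguration 3, Q.energyPerParticle lennardJones

/-- Mean root energy `E_P[h]`, `h μ = ½ ∫ V_LJ(‖y‖) dμ` (the route's inlined Bochner term). -/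
def meanRootEnergy (P : Measure (Measure (EuclideanSpace ℝ (Fin 3)))) : ℝ := ∫ μ, (∫ y, lennardJones ‖y‖ ∂μ) / 2 ∂P

/-- The crux's conclusion for one rooted configuration `μ`: a `(a/100)`-close-packed root shell at
some scale `a ∈ [9/10, 1]` (FCC or HCP pattern, radius `5a/4`; the route's inlined predicate). -/
def GoodShell (μ : Measure (EuclideanSpace ℝ (Fin 3))) : Prop :=
  ∃ a : ℝ, 9 / 10 ≤ a ∧ a ≤ 1 ∧ ∃ T : Finset (EuclideanSpace ℝ (Fin 3)),
    (↑T : Set (EuclideanSpace ℝ (Fin 3))) = {y : (EuclideanSpace ℝ (Fin 3)) | μ {y} ≠ 0 ∧ y ≠ 0 ∧ ‖y‖ ≤ 5 / 4 * a} ∧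
    (ShellCloseTo (a / 100) T (Finset.image (fun v : (EuclideanSpace ℝ (Fin 3)) => a • v) fccKissingPattern) ∨
      ShellCloseTo (a / 100) T (Finset.image (fun v : (EuclideanSpace ℝ (Fin 3)) => a • v) hcpKissingPattern))

/-- READ-BACK: the crux, folded into the Literature vocabulary (definitional). [folklore] -/
theorem minimiserShells_iff :
    MinimiserShells ↔ ∀ δ : ℝ, 0 < δ → ∀ P : Measure (Measure (EuclideanSpace ℝ (Fin 3))), IsProbabilityMeasure P →
      (∀ᵐ μ ∂P, IsRootedHardCore δ μ) → IsPointStationaryLaw P → meanRootEnergy P ≤ eStar →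
      ∀ᵐ μ ∂P, GoodShell μ :=
  Iff.rfl

/-! ## Shell bookkeeping -/

/-- If every configuration point other than the root lies outside the closed ball of radius `5/4`,
the root shell is bad (the shell set is empty; a good shell has twelve points). [folklore] -/
theorem not_goodShell_of_far {μ : Measure (EuclideanSpace ℝ (Fin 3))}
    (h : ∀ y : (EuclideanSpace ℝ (Fin 3)), μ {y} ≠ 0 → y ≠ 0 → (5 : ℝ) / 4 < ‖y‖) : ¬ GoodShell μ := by
  rintro ⟨a, ha₁, ha₂, T, hT, hclose⟩
  have ha0 : a ≠ 0 := by linarith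
  have hTempty : T = ∅ := by
    rw [← Finset.coe_eq_empty, hT]
    ext y
    simp only [Set.mem_setOf_eq, Set.mem_empty_iff_false, iff_false, not_and, not_le]
    intro hy hy0
    calc 5 / 4 * a ≤ 5 / 4 * 1 := by gcongr
      _ < ‖y‖ := by rw [mul_one]; exact h y hy hy0
  have hcard : T.card = 12 := by
    rcases hclose with hc | hc
    · rw [hc.card_eq, Finset.card_image_of_injective _ (smul_right_injective (EuclideanSpace ℝ (Fin 3)) ha0),
        card_fccKissingPattern]
    · rw [hc.card_eq, Finset.card_image_of_injective _ (smul_right_injective (EuclideanSpace ℝ (Fin 3)) ha0),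
        card_hcpKissingPattern]
  rw [hTempty, Finset.card_empty] at hcard
  exact absurd hcard (by norm_num)

/-- The lone root `δ_0` has a bad (empty) shell. [folklore] -/
theorem not_goodShell_dirac_zero : ¬ GoodShell (Measure.dirac (0 : (EuclideanSpace ℝ (Fin 3)))) := by
  refine not_goodShell_of_far fun y hy hy0 => ?_
  exfalso
  apply hy
  rw [Measure.dirac_apply' _ (measurableSet_singleton y)]
  exact Set.indicator_of_notMem
    (fun h0 : (0 : (EuclideanSpace ℝ (Fin 3))) ∈ ({y} : Set (EuclideanSpace ℝ (Fin 3))) => hy0 (Set.mem_singleton_iff.1 h0).symm) _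

/-! ## The minimising hypothesis is load-bearing -/

/-- **Any proof of `MinimiserShells` must use `E_P[h] ≤ e*`**: with that hypothesis dropped the
statement fails for the lone root `P = δ_{δ_0}` (point-stationary: `isPointStationaryLaw_dirac_dirac_zero`;
hard core: `isRootedHardCore_dirac_zero`; shell: empty). [folklore] -/
theorem minimiserShells_false_without_energy :
    ¬ (∀ δ : ℝ, 0 < δ → ∀ P : Measure (Measure (EuclideanSpace ℝ (Fin 3))), IsProbabilityMeasure P →
      (∀ᵐ μ ∂P, IsRootedHardCore δ μ) → IsPointStationaryLaw P → ∀ᵐ μ ∂P, GoodShell μ) := by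
  intro h
  have hae := ae_dirac_dirac_zero (G := (EuclideanSpace ℝ (Fin 3))) (measurableSet_singleton 0)
  have hgood := h 1 one_pos (Measure.dirac (Measure.dirac (0 : (EuclideanSpace ℝ (Fin 3))))) inferInstance
    (hae.mono fun μ hμ => by rw [hμ]; exact isRootedHardCore_dirac_zero 1)
    isPointStationaryLaw_dirac_dirac_zero
  obtain ⟨μ, hμg, hμe⟩ := (hgood.and hae).exists
  rw [hμe] at hμg
  exact not_goodShell_dirac_zero hμg

/-! ## The collinear comb -/

/-- The unit vector `e₀`. -/
def e0 : (EuclideanSpace ℝ (Fin 3)) := EuclideanSpace.single 0 1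

/-- The `k`-th comb point `(3/2 + k/(2(m+1))) • e₀`. -/
def combPt (m k : ℕ) : (EuclideanSpace ℝ (Fin 3)) := ((3 : ℝ) / 2 + (k : ℝ) / (2 * ((m : ℝ) + 1))) • e0

/-- The comb configuration: the root plus `m` comb points on `[3/2, 2)·e₀`. -/
def comb (m : ℕ) : Finset (EuclideanSpace ℝ (Fin 3)) := insert 0 ((Finset.range m).image (combPt m))

/-- `‖combPt m k‖ = 3/2 + k/(2(m+1))`. [folklore] -/
theorem norm_combPt (m k : ℕ) : ‖combPt m k‖ = 3 / 2 + (k : ℝ) / (2 * ((m : ℝ) + 1)) := by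
  have he0 : ‖e0‖ = 1 := by simp [e0]
  rw [combPt, norm_smul, he0, mul_one, Real.norm_of_nonneg (by positivity)]

/-- Comb points are at distance `≥ 3/2` from the root. [folklore] -/
theorem le_norm_combPt (m k : ℕ) : (3 : ℝ) / 2 ≤ ‖combPt m k‖ := by
  rw [norm_combPt]
  have : (0 : ℝ) ≤ (k : ℝ) / (2 * ((m : ℝ) + 1)) := by positivity
  linarith

/-- Comb points are at distance `≤ 2` from the root. [folklore] -/
theorem norm_combPt_le {m k : ℕ} (hk : k < m) : ‖combPt m k‖ ≤ 2 := by
  rw [norm_combPt]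
  have hm : (0 : ℝ) < 2 * ((m : ℝ) + 1) := by positivity
  have hk' : (k : ℝ) ≤ (m : ℝ) + 1 := by
    have : (k : ℝ) < m := by exact_mod_cast hk
    linarith
  have : (k : ℝ) / (2 * ((m : ℝ) + 1)) ≤ 1 / 2 := by
    rw [div_le_iff₀ hm]
    linarith
  linarith

/-- Comb points are not the root. [folklore] -/
theorem combPt_ne_zero (m k : ℕ) : combPt m k ≠ 0 := by
  intro h
  have := le_norm_combPt m k
  rw [h, norm_zero] at this
  linarith

/-- Distances along the comb. [folklore] -/
theorem dist_combPt (m k l : ℕ) :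
    dist (combPt m k) (combPt m l) = |(k : ℝ) - l| / (2 * ((m : ℝ) + 1)) := by
  have he0 : ‖e0‖ = 1 := by simp [e0]
  rw [dist_eq_norm, combPt, combPt, ← sub_smul, norm_smul, he0, mul_one]
  have hm : (0 : ℝ) < 2 * ((m : ℝ) + 1) := by positivity
  rw [show (3 : ℝ) / 2 + (k : ℝ) / (2 * ((m : ℝ) + 1)) - (3 / 2 + (l : ℝ) / (2 * ((m : ℝ) + 1))) =
      ((k : ℝ) - l) / (2 * ((m : ℝ) + 1)) by ring, Real.norm_eq_abs, abs_div,
    abs_of_pos hm]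

/-- The comb points are pairwise distinct. [folklore] -/
theorem combPt_injective (m : ℕ) : Function.Injective (combPt m) := by
  intro k l h
  have hd := dist_combPt m k l
  rw [h, dist_self] at hd
  have hm : (0 : ℝ) < 2 * ((m : ℝ) + 1) := by positivity
  have : |(k : ℝ) - l| = 0 := by
    have := hd.symm
    rwa [div_eq_zero_iff, or_iff_left hm.ne'] at this
  have : (k : ℝ) = l := by
    have := abs_eq_zero.1 this
    linarith
  exact_mod_cast this

/-- The comb is `1/(2(m+1))`-separated. [folklore] -/
theorem comb_separated (m : ℕ) :
    ∀ x ∈ (↑(comb m) : Set (EuclideanSpace ℝ (Fin 3))), ∀ y ∈ (↑(comb m) : Set (EuclideanSpace ℝ (Fin 3))), x ≠ y →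
      1 / (2 * ((m : ℝ) + 1)) ≤ dist x y := by
  have hm : (0 : ℝ) < 2 * ((m : ℝ) + 1) := by positivity
  have hsmall : 1 / (2 * ((m : ℝ) + 1)) ≤ 3 / 2 := by
    rw [div_le_iff₀ hm]
    have : (0 : ℝ) ≤ m := by positivity
    linarith
  intro x hx y hy hxy
  simp only [comb, Finset.coe_insert, Finset.coe_image, Finset.coe_range, Set.mem_insert_iff,
    Set.mem_image, Set.mem_Iio] at hx hy
  rcases hx with rfl | ⟨k, hk, rfl⟩ <;> rcases hy with rfl | ⟨l, hl, rfl⟩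
  · exact absurd rfl hxy
  · rw [dist_comm, dist_zero_right]
    exact hsmall.trans (le_norm_combPt m l)
  · rw [dist_zero_right]
    exact hsmall.trans (le_norm_combPt m k)
  · rw [dist_combPt]
    have hkl : k ≠ l := fun h => hxy (by rw [h])
    have : (1 : ℝ) ≤ |(k : ℝ) - l| := by
      rcases lt_or_gt_of_ne hkl with h | h
      · have : (k : ℝ) + 1 ≤ l := by exact_mod_cast h
        rw [abs_of_neg (by linarith)]
        linarith
      · have : (l : ℝ) + 1 ≤ k := by exact_mod_cast h
        rw [abs_of_pos (by linarith)]
        linarith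
    exact div_le_div_of_nonneg_right this hm.le

/-- The comb is a rooted `1/(2(m+1))`-hard-core configuration. [folklore] -/
theorem isRootedHardCore_comb (m : ℕ) :
    IsRootedHardCore (1 / (2 * ((m : ℝ) + 1)))
      ((Measure.count : Measure (EuclideanSpace ℝ (Fin 3))).restrict (↑(comb m) : Set (EuclideanSpace ℝ (Fin 3)))) :=
  ⟨↑(comb m), by simp [comb], comb_separated m, rfl⟩

/-- `V_LJ ≤ −1/1000` on `[3/2, 2]` (`w = r⁻⁶ ∈ [1/64, 64/729]`, `V = w²/12 − w/6`). [folklore] -/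
theorem lennardJones_le_on_comb_annulus {r : ℝ} (h1 : (3 : ℝ) / 2 ≤ r) (h2 : r ≤ 2) :
    lennardJones r ≤ -(1 / 1000) := by
  have hr : 0 < r := by linarith
  have hu0 : 1 / 2 ≤ r⁻¹ := by
    rw [inv_eq_one_div, le_div_iff₀ hr]; linarith
  have hu1 : r⁻¹ ≤ 2 / 3 := by
    rw [inv_eq_one_div, div_le_iff₀ hr]; linarith
  have hw0 : ((1 : ℝ) / 2) ^ 6 ≤ (r⁻¹) ^ 6 := pow_le_pow_left₀ (by norm_num) hu0 6
  have hw1 : (r⁻¹) ^ 6 ≤ ((2 : ℝ) / 3) ^ 6 := pow_le_pow_left₀ (by positivity) hu1 6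
  unfold lennardJones
  have h12 : (r⁻¹) ^ 12 = ((r⁻¹) ^ 6) ^ 2 := by ring
  rw [h12]
  nlinarith [hw0, hw1, mul_nonneg (sub_nonneg.2 hw0) (sub_nonneg.2 hw1)]

/-- Root energy of the comb: `½ Σ_y V_LJ(‖y‖) ≤ −m/2000`. [folklore] -/
theorem rootEnergy_comb_le (m : ℕ) :
    (∫ y, lennardJones ‖y‖ ∂((Measure.count : Measure (EuclideanSpace ℝ (Fin 3))).restrict (↑(comb m) : Set (EuclideanSpace ℝ (Fin 3))))) / 2 ≤
      -((m : ℝ) / 2000) := by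
  rw [integral_count_restrict_coe_finset]
  have h0 : (0 : (EuclideanSpace ℝ (Fin 3))) ∉ (Finset.range m).image (combPt m) := by
    simp only [Finset.mem_image, Finset.mem_range, not_exists, not_and]
    exact fun k _ => combPt_ne_zero m k
  rw [comb, Finset.sum_insert h0, norm_zero, lennardJones_zero, zero_add,
    Finset.sum_image fun k _ l _ h => combPt_injective m h]
  have hle : ∑ k ∈ Finset.range m, lennardJones ‖combPt m k‖ ≤
      ∑ k ∈ Finset.range m, (-(1 / 1000) : ℝ) :=
    Finset.sum_le_sum fun k hk => lennardJones_le_on_comb_annulus (le_norm_combPt m k)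
      (norm_combPt_le (Finset.mem_range.1 hk))
  rw [Finset.sum_const, Finset.card_range, nsmul_eq_mul] at hle
  linarith

/-- The comb's root shell is empty, hence bad. [folklore] -/
theorem not_goodShell_comb (m : ℕ) :
    ¬ GoodShell ((Measure.count : Measure (EuclideanSpace ℝ (Fin 3))).restrict (↑(comb m) : Set (EuclideanSpace ℝ (Fin 3)))) := by
  refine not_goodShell_of_far fun y hy hy0 => ?_
  rw [count_restrict_singleton_ne_zero_iff] at hy
  simp only [comb, Finset.coe_insert, Finset.coe_image, Finset.coe_range, Set.mem_insert_iff,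
    Set.mem_image, Set.mem_Iio] at hy
  rcases hy with rfl | ⟨k, -, rfl⟩
  · exact absurd rfl hy0
  · exact lt_of_lt_of_le (by norm_num) (le_norm_combPt m k)

/-- The comb size that beats `e*`: `⌈−2000 e*⌉₊` (whatever the value of the real number `e*`). -/
def combSize : ℕ := ⌈-2000 * eStar⌉₊

/-- The comb of size `combSize` has root energy `≤ e*`. [folklore] -/
theorem rootEnergy_comb_le_eStar :
    (∫ y, lennardJones ‖y‖ ∂((Measure.count : Measure (EuclideanSpace ℝ (Fin 3))).restrict (↑(comb combSize) : Set (EuclideanSpace ℝ (Fin 3))))) / 2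
      ≤ eStar := by
  have h1 := rootEnergy_comb_le combSize
  have h2 : -2000 * eStar ≤ (combSize : ℝ) := Nat.le_ceil _
  linarith

/-- **The pointwise version of the crux is false**: "a rooted hard-core configuration whose ROOT
energy is `≤ e*` has a good root shell" fails for the comb — low root energy can be bought with
many far points. [folklore] -/
theorem not_pointwiseMinimiserShells :
    ¬ (∀ δ : ℝ, 0 < δ → ∀ μ : Measure (EuclideanSpace ℝ (Fin 3)), IsRootedHardCore δ μ →
      (∫ y, lennardJones ‖y‖ ∂μ) / 2 ≤ eStar → GoodShell μ) := fun h =>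
  not_goodShell_comb combSize
    (h _ (by positivity) _ (isRootedHardCore_comb combSize) rootEnergy_comb_le_eStar)

/-! ## Point-stationarity is load-bearing -/

/-- The set `{count|F}` (`F` finite) is measurable in the Giry σ-algebra: it is cut out by
`μ Fᶜ = 0` and the finitely many evaluations `μ {s} = 1`, `s ∈ F`. [folklore] -/
theorem measurableSet_setOf_eq_count_restrict (F : Finset (EuclideanSpace ℝ (Fin 3))) :
    MeasurableSet {μ : Measure (EuclideanSpace ℝ (Fin 3)) | μ = (Measure.count : Measure (EuclideanSpace ℝ (Fin 3))).restrict (↑F : Set (EuclideanSpace ℝ (Fin 3)))} := by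
  classical
  have hrepr : {μ : Measure (EuclideanSpace ℝ (Fin 3)) | μ = (Measure.count : Measure (EuclideanSpace ℝ (Fin 3))).restrict (↑F : Set (EuclideanSpace ℝ (Fin 3)))} =
      {μ : Measure (EuclideanSpace ℝ (Fin 3)) | μ (↑F : Set (EuclideanSpace ℝ (Fin 3)))ᶜ = 0} ∩ ⋂ s ∈ F, {μ : Measure (EuclideanSpace ℝ (Fin 3)) | μ {s} = 1} := by
    ext μ
    simp only [Set.mem_setOf_eq, Set.mem_inter_iff, Set.mem_iInter]
    constructor
    · rintro rfl
      refine ⟨?_, fun s hs => ?_⟩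
      · rw [Measure.restrict_apply F.measurableSet.compl, Set.compl_inter_self, measure_empty]
      · rw [Measure.restrict_apply (measurableSet_singleton s),
          Set.inter_eq_left.2 (Set.singleton_subset_iff.2 (Finset.mem_coe.2 hs)),
          Measure.count_singleton]
    · rintro ⟨hc, h1⟩
      ext A hA
      rw [Measure.restrict_apply hA]
      have hdiff : μ (A \ ↑F) = 0 := measure_mono_null (fun x hx => hx.2) hc
      rw [← measure_inter_add_sdiff A F.measurableSet, hdiff, add_zero]
      have hAF : A ∩ ↑F = ↑(F.filter fun s => s ∈ A) := by
        ext x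
        simp [and_comm]
      rw [hAF, ← sum_measure_singleton, ← sum_measure_singleton]
      refine Finset.sum_congr rfl fun s hs => ?_
      rw [h1 s (Finset.mem_filter.1 hs).1, Measure.count_singleton]
  rw [hrepr]
  refine MeasurableSet.inter ?_ (F.measurableSet_biInter fun s _ => ?_)
  · exact (Measure.measurable_coe F.measurableSet.compl) (measurableSet_singleton 0)
  · exact (Measure.measurable_coe (measurableSet_singleton s)) (measurableSet_singleton 1)

/-- Under `δ_{count|F}` almost every configuration IS `count|F`. [folklore] -/
theorem ae_eq_dirac_count_restrict (F : Finset (EuclideanSpace ℝ (Fin 3))) :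
    ∀ᵐ μ ∂(Measure.dirac ((Measure.count : Measure (EuclideanSpace ℝ (Fin 3))).restrict (↑F : Set (EuclideanSpace ℝ (Fin 3)))) :
      Measure (Measure (EuclideanSpace ℝ (Fin 3)))), μ = (Measure.count : Measure (EuclideanSpace ℝ (Fin 3))).restrict (↑F : Set (EuclideanSpace ℝ (Fin 3))) := by
  rw [ae_iff]
  have h : {μ : Measure (EuclideanSpace ℝ (Fin 3)) | ¬μ = (Measure.count : Measure (EuclideanSpace ℝ (Fin 3))).restrict (↑F : Set (EuclideanSpace ℝ (Fin 3)))} =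
      {μ : Measure (EuclideanSpace ℝ (Fin 3)) | μ = (Measure.count : Measure (EuclideanSpace ℝ (Fin 3))).restrict (↑F : Set (EuclideanSpace ℝ (Fin 3)))}ᶜ := rfl
  rw [h, Measure.dirac_apply' _ (measurableSet_setOf_eq_count_restrict F).compl]
  simp

/-- Mean root energy of a deterministic finite configuration: `E_{δ_{count|F}}[h] = h(count|F)`.
[folklore] -/
theorem meanRootEnergy_dirac_count_restrict (F : Finset (EuclideanSpace ℝ (Fin 3))) :
    meanRootEnergy (Measure.dirac ((Measure.count : Measure (EuclideanSpace ℝ (Fin 3))).restrict (↑F : Set (EuclideanSpace ℝ (Fin 3))))) =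
      (∫ y, lennardJones ‖y‖ ∂((Measure.count : Measure (EuclideanSpace ℝ (Fin 3))).restrict (↑F : Set (EuclideanSpace ℝ (Fin 3))))) / 2 := by
  unfold meanRootEnergy
  set μ₀ := (Measure.count : Measure (EuclideanSpace ℝ (Fin 3))).restrict (↑F : Set (EuclideanSpace ℝ (Fin 3)))
  have heq : (fun μ : Measure (EuclideanSpace ℝ (Fin 3)) => (∫ y, lennardJones ‖y‖ ∂μ) / 2) =ᵐ[(Measure.dirac μ₀ :
      Measure (Measure (EuclideanSpace ℝ (Fin 3))))] fun _ => (∫ y, lennardJones ‖y‖ ∂μ₀) / 2 :=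
    (ae_eq_dirac_count_restrict F).mono fun μ hμ => by simp only [hμ, μ₀]
  rw [integral_congr_ae heq]
  simp

/-- **Any proof of `MinimiserShells` must use the Mecke identity**: with point-stationarity dropped
the statement fails for the deterministic law `δ_{count|comb}` (hard core `1/(2m+2)`, mean root
energy `≤ e*`, empty root shell). [folklore] -/
theorem minimiserShells_false_without_stationarity :
    ¬ (∀ δ : ℝ, 0 < δ → ∀ P : Measure (Measure (EuclideanSpace ℝ (Fin 3))), IsProbabilityMeasure P →
      (∀ᵐ μ ∂P, IsRootedHardCore δ μ) → meanRootEnergy P ≤ eStar → ∀ᵐ μ ∂P, GoodShell μ) := by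
  intro h
  have hae := ae_eq_dirac_count_restrict (comb combSize)
  have hE : meanRootEnergy (Measure.dirac ((Measure.count : Measure (EuclideanSpace ℝ (Fin 3))).restrict
      (↑(comb combSize) : Set (EuclideanSpace ℝ (Fin 3))))) ≤ eStar := by
    rw [meanRootEnergy_dirac_count_restrict]
    exact rootEnergy_comb_le_eStar
  have hgood := h _ (by positivity : (0 : ℝ) < 1 / (2 * ((combSize : ℝ) + 1))) _ inferInstance
    (hae.mono fun μ hμ => by rw [hμ]; exact isRootedHardCore_comb combSize) hE
  obtain ⟨μ, hμg, hμe⟩ := (hgood.and hae).exists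
  rw [hμe] at hμg
  exact not_goodShell_comb combSize hμg

end Summit.AtomisticToContinuum.Crystallization.Theorems.MinimiserShells.Negative.LoadBearing
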